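import Summits.MatrixMultiplication.OmegaCensus.SmallFormats.GF2Rank223Cert
import Summits.MatrixMultiplication.OmegaCensus.SmallFormats.GF2Rank224Cert
import Summits.MatrixMultiplication.OmegaCensus.SmallFormats.GF2Rank233Cert
import HarnessLib

/-!
# ω-census family (a): the kernel GF(2) values in all format orientations

Cell `pub-omega` (unit `pub-omega-lit`, gen 5), topic `Summits/MatrixMultiplication/OmegaCensus` (sub-folder
`SmallFormats`). Framing (verbatim): lottery ticket; floor = certified bounds/negative ranges. HONEST FRAMING:
bookkeeping only — the three kernel-certified values `R_𝔽₂(⟨2,2,3⟩) = 11`, `R_𝔽₂(⟨2,2,4⟩) = 14`,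
`R_𝔽₂(⟨2,3,3⟩) = 15` (`GF2Rank223Cert`, `GF2Rank224Cert`, `GF2Rank233Cert`) transported to the other orientations
of the same formats by the tree's cyclic symmetry `tensorRank_matMulTensor_rotate` (`R(⟨k,m,n⟩) = R(⟨m,n,k⟩)`), so
that census rows can cite the printed orientations (Hopcroft–Kerr 1971 state `⟨3,2,3⟩` and `p × 2` by `2 × n`).
Nothing here is progress on `ω`. PROVED, no facts.
-/

namespace Summit.MatrixMultiplication.OmegaCensus.GF2RankLB

open Literature.Computability.AlgebraicComplexity

/-- `R_𝔽₂(⟨2,3,2⟩) = 11`. -/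
theorem tensorRank_matMulTensor_232_gf2 : tensorRank (matMulTensor (ZMod 2) 2 3 2) = 11 := by
  rw [← tensorRank_matMulTensor_rotate (ZMod 2) 2 2 3]
  exact Cert223.tensorRank_matMulTensor_223_gf2

/-- `R_𝔽₂(⟨3,2,2⟩) = 11` (Hopcroft–Kerr's `3 × 2` by `2 × 2`). -/
theorem tensorRank_matMulTensor_322_gf2 : tensorRank (matMulTensor (ZMod 2) 3 2 2) = 11 := by
  rw [← tensorRank_matMulTensor_rotate (ZMod 2) 2 3 2]
  exact tensorRank_matMulTensor_232_gf2

/-- `R_𝔽₂(⟨2,4,2⟩) = 14`. -/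
theorem tensorRank_matMulTensor_242_gf2 : tensorRank (matMulTensor (ZMod 2) 2 4 2) = 14 := by
  rw [← tensorRank_matMulTensor_rotate (ZMod 2) 2 2 4]
  exact Cert224.tensorRank_matMulTensor_224_gf2

/-- `R_𝔽₂(⟨4,2,2⟩) = 14` (Hopcroft–Kerr's `4 × 2` by `2 × 2`). -/
theorem tensorRank_matMulTensor_422_gf2 : tensorRank (matMulTensor (ZMod 2) 4 2 2) = 14 := by
  rw [← tensorRank_matMulTensor_rotate (ZMod 2) 2 4 2]
  exact tensorRank_matMulTensor_242_gf2

/-- `R_𝔽₂(⟨3,3,2⟩) = 15`. -/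
theorem tensorRank_matMulTensor_332_gf2 : tensorRank (matMulTensor (ZMod 2) 3 3 2) = 15 := by
  rw [← tensorRank_matMulTensor_rotate (ZMod 2) 2 3 3]
  exact Cert233.tensorRank_matMulTensor_233_gf2

/-- `R_𝔽₂(⟨3,2,3⟩) = 15` (the orientation printed by Hopcroft–Kerr 1971: "an algorithm for `⟨3,2,3;15⟩` … fewer
than `15` multiplications is not possible"). -/
theorem tensorRank_matMulTensor_323_gf2 : tensorRank (matMulTensor (ZMod 2) 3 2 3) = 15 := by
  rw [← tensorRank_matMulTensor_rotate (ZMod 2) 3 3 2]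
  exact tensorRank_matMulTensor_332_gf2

end Summit.MatrixMultiplication.OmegaCensus.GF2RankLB
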